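import Literature.Computability.QuantumComplexity.NonlocalGameClassicalValue
import Literature.InformationTheory.Entanglement.TsirelsonBound
import HarnessLib

/-!
# The Magic Square game: `ω_c = 17/18`, and the Mermin–Peres square of observables

Topic `Literature/Computability/QuantumComplexity`, a companion of `NonlocalGameClassicalValue.lean`
(`NonlocalGame`, `detValue`, `classicalValue` = the maximum over deterministic strategies,
`mixedValue_le_classicalValue`, `classicalValue_chsh = 3/4`).  Source (held text
`paper:arxiv-quant-ph_0404076`, read at the cited places):

* R. Cleve, P. Høyer, B. Toner, J. Watrous, *Consequences and limits of nonlocal strategies*,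
  CCC 2004 = arXiv:quant-ph/0404076 [CleveEtAl2004], §3.3 (The Magic Square game): “based on the
  fact that there does not exist a 3 × 3 binary matrix with the property that each row has even
  parity and each column has odd parity … ask Alice to fill in the values in either a row or a
  column of the matrix (randomly selected) and to ask Bob to fill in a single entry of the
  matrix, that is randomly chosen among the three entries given to Alice. The requirement is that
  the parity conditions are met by Alice's answers (even for rows, odd for columns) and that
  Bob's answer is consistent with Alice's answers. Formally, let S = ℤ₆ index the six possible
  questions to Alice (three rows plus three columns) and let T = ℤ₉ index the nine possible
  questions to Bob … A = {0,1}³ and B = {0,1}. The predicate V(a,b|s,t) is defined to take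
  value 1 if and only if a has the appropriate parity (0 for a row and 1 for a column) and the
  entry of a corresponding to t has value b. The distribution π is the uniform distribution
  over {(s,t) ∈ S × T : entry t is in triple s}. It is not hard to see that ω_c(G) = 17/18 for
  this game.”; and, for the perfect quantum strategy, the `3 × 3` matrix of observables
  `[[σx⊗σy, σy⊗σx, σz⊗σz], [σy⊗σz, σz⊗σy, σx⊗σx], [σz⊗σx, σx⊗σz, σy⊗σy]]` with the three
  “basic observations”: “|ψ⁻⟩ is a −1 eigenvector of each of the operators σx⊗σx, σy⊗σy, and
  σz⊗σz”, “the Pauli matrices anti-commute in pairs … This implies that the observables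
  commute within any row or column”, “the product of the observables in each row is equal to
  𝟙⊗𝟙, while the product of the observables in each column is −𝟙⊗𝟙. This implies that
  Alice's parity requirements are always met.”

HONEST FRAMING (pub-qadeq lane — nonlocal-game benchmarks E-76 / E-78 read against classical
values, and the Mermin–Peres magic square as the primitive of ‘quantum advantage with (noisy)
shallow circuits’ A-rows): instance-level adjudication of specific advantage claims; no claim
about BQP vs BPP or the summit.  This file certifies the CLASSICAL value `17/18` of the CHTW
magic square game in the tree's `NonlocalGame` framework (a maximum over the `8⁶ · 2⁹`
deterministic strategies, not exceeded by shared randomness — `mixedValue_le_classicalValue`)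
and the operator algebra of the Mermin–Peres square; it does NOT formalise the measurement
model in which that algebra yields a strategy winning with probability `1` (sequential
measurement of three commuting two-qubit observables on two shared singlets), nor any device.

## Contents (all proved, 0 named facts)

* `MagicSquare.S = Fin 3 ⊕ Fin 3` (rows `inl r`, columns `inr c`), `MagicSquare.T = Fin 3 × Fin 3`,
  `inTriple`, `idx`, `parity`, `requiredParity`, `MagicSquare.win`, and the game
  **`magicSquare : NonlocalGame S T (Fin 3 → Bool) Bool`** (`π = 1/18` on the 18 pairs).
* `detValue_eq` (value `= #wins / 18`), **`no_parity_matrix`** (no binary `3 × 3` matrix with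
  even rows and odd columns), **`exists_loss`** (every deterministic strategy loses an in-support
  pair), `card_winSet_le` (`≤ 17`), **`detValue_le`** (`≤ 17/18`), the explicit optimal strategy
  `alice₀`, `bob₀` with `detValue_alice₀_bob₀ = 17/18`, and
  **`classicalValue_magicSquare : magicSquare.classicalValue = 17/18`**.
* The Mermin–Peres square `MagicSquare.obs i j` (two-qubit Pauli products, `Pauli.mat` of
  `PauliExpansion.lean`, Kronecker `⊗ₖ`): `pauli_mul_table`, **`obs_mul_self`** (`O² = 𝟙`),
  **`obs_row_comm`**, **`obs_col_comm`**, **`obs_row_prod`** (`= 𝟙`), **`obs_col_prod`** (`= −𝟙`),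
  **`psiMinus_eigen`** (`(σ_i ⊗ σ_i)|ψ⁻⟩ = −|ψ⁻⟩`), `psiMinus_expect_diag` (the tree's
  `Tsirelson.Werner.expect_diag`).

## Mathlib / tree search

Mathlib: no nonlocal games / magic square (`Mathlib.Algebra.Star.CHSH` only).  Tree:
`NonlocalGameClassicalValue.lean` (framework, CHSH `3/4`, colouring games), `G14ColoringGame.lean`
(`86/88`), `RendezvousGame.lean` (`7/12`), `TsirelsonBound.lean` (`vecState`, `Werner.psiMinus`,
`Werner.expect_diag`), `ShallowCircuitsGame.lean` (BGK cycle game, combinatorial) — the magic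
square value `17/18` and the Mermin–Peres operator identities are new.  Mathlib's
`Matrix.mul_kronecker_mul` (`(AB) ⊗ (A′B′) = (A ⊗ A′)(B ⊗ B′)`) is used right-to-left.
-/

namespace Literature.Computability.QuantumComplexity

open Finset

/-! ## The Magic Square game (CHTW §3.3) -/

namespace MagicSquare

/-- Questions to Alice: a row (`inl r`) or a column (`inr c`) of the `3 × 3` square
(CHTW: `S = ℤ₆`). [cite: CleveEtAl2004, §3.3] -/
abbrev S : Type := Fin 3 ⊕ Fin 3

/-- Questions to Bob: an entry of the square (CHTW: `T = ℤ₉`). [cite: CleveEtAl2004, §3.3] -/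
abbrev T : Type := Fin 3 × Fin 3

/-- “entry `t` is in triple `s`”. [cite: CleveEtAl2004, §3.3 (the support of π)] -/
def inTriple : S → T → Bool
  | .inl r, t => decide (t.1 = r)
  | .inr c, t => decide (t.2 = c)

/-- The position of entry `t` inside triple `s` (column index inside a row, row index inside a
column). [cite: CleveEtAl2004, §3.3 (“the entry of a corresponding to t”)] -/
def idx : S → T → Fin 3
  | .inl _, t => t.2
  | .inr _, t => t.1

/-- The parity of Alice's three bits. [cite: CleveEtAl2004, §3.3] -/
def parity (a : Fin 3 → Bool) : Bool := xor (xor (a 0) (a 1)) (a 2)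

/-- The required parity: `0` (even) for a row, `1` (odd) for a column. [cite: CleveEtAl2004, §3.3] -/
def requiredParity : S → Bool
  | .inl _ => false
  | .inr _ => true

/-- The predicate `V(a, b | s, t)`: “`a` has the appropriate parity (0 for a row and 1 for a column)
and the entry of `a` corresponding to `t` has value `b`”. [cite: CleveEtAl2004, §3.3] -/
def win (s : S) (t : T) (a : Fin 3 → Bool) (b : Bool) : Bool :=
  (parity a == requiredParity s) && (a (idx s t) == b)

end MagicSquare

open MagicSquare in
/-- **The Magic Square game** `G = G(V, π)`: `S = ℤ₆` (rows and columns), `T = ℤ₉` (entries),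
`A = {0,1}³`, `B = {0,1}`, `π` uniform on the `18` pairs `{(s,t) : entry t is in triple s}`, and
`V` as in `MagicSquare.win`. [cite: CleveEtAl2004, §3.3] -/
noncomputable def magicSquare : NonlocalGame S T (Fin 3 → Bool) Bool where
  prior s t := if inTriple s t then 1 / 18 else 0
  prior_nonneg s t := by split_ifs <;> norm_num
  win := win

namespace MagicSquare

/-- The winning in-support question pairs of a deterministic strategy. [cite: CleveEtAl2004, §3.3] -/
def winSet (a : S → Fin 3 → Bool) (b : T → Bool) : Finset (S × T) :=
  univ.filter fun st => inTriple st.1 st.2 = true ∧ win st.1 st.2 (a st.1) (b st.2) = true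

/-- The support of `π`: the `18` pairs (triple, entry in it). [cite: CleveEtAl2004, §3.3] -/
def tripleSet : Finset (S × T) := univ.filter fun st => inTriple st.1 st.2 = true

/-- There are `18` (triple, entry) pairs. [cite: CleveEtAl2004, §3.3] -/
theorem card_tripleSet : tripleSet.card = 18 := by decide

/-- The value of a deterministic strategy is `(number of winning in-support pairs)/18`.
[cite: CleveEtAl2004, §2 (ω_c as a maximum over deterministic strategies), §3.3] -/
theorem detValue_eq (a : S → Fin 3 → Bool) (b : T → Bool) :
    magicSquare.detValue a b = (winSet a b).card / 18 := by
  unfold NonlocalGame.detValue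
  have h : ∀ s t, magicSquare.prior s t * (if magicSquare.win s t (a s) (b t) then (1 : ℝ) else 0)
      = (if inTriple s t = true ∧ win s t (a s) (b t) = true then (1 : ℝ) else 0) / 18 := by
    intro s t
    simp only [magicSquare]
    by_cases h1 : inTriple s t = true <;> by_cases h2 : win s t (a s) (b t) = true <;> simp [h1, h2]
  simp_rw [h]
  rw [← Fintype.sum_prod_type' (f := fun s t =>
    (if inTriple s t = true ∧ win s t (a s) (b t) = true then (1 : ℝ) else 0) / 18),
    ← Finset.sum_div, Finset.sum_boole]
  rfl

/-- **The parity obstruction**: “there does not exist a 3 × 3 binary matrix with the property that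
each row has even parity and each column has odd parity”. [cite: CleveEtAl2004, §3.3] -/
theorem no_parity_matrix (M : T → Bool)
    (hrow : ∀ r : Fin 3, xor (xor (M (r, 0)) (M (r, 1))) (M (r, 2)) = false)
    (hcol : ∀ c : Fin 3, xor (xor (M (0, c)) (M (1, c))) (M (2, c)) = true) : False := by
  have r0 := hrow 0; have r1 := hrow 1; have r2 := hrow 2
  have c0 := hcol 0; have c1 := hcol 1; have c2 := hcol 2
  revert r0 r1 r2 c0 c1 c2
  generalize M (0, 0) = m₀₀; generalize M (0, 1) = m₀₁; generalize M (0, 2) = m₀₂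
  generalize M (1, 0) = m₁₀; generalize M (1, 1) = m₁₁; generalize M (1, 2) = m₁₂
  generalize M (2, 0) = m₂₀; generalize M (2, 1) = m₂₁; generalize M (2, 2) = m₂₂
  revert m₀₀ m₀₁ m₀₂ m₁₀ m₁₁ m₁₂ m₂₀ m₂₁ m₂₂
  decide

/-- Every deterministic strategy loses some in-support question pair: if Alice's answers met all
parity constraints and agreed with Bob everywhere, Bob's answers `b : T → {0,1}` would be a binary
matrix with even rows and odd columns. [cite: CleveEtAl2004, §3.3] -/
theorem exists_loss (a : S → Fin 3 → Bool) (b : T → Bool) :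
    ∃ s t, inTriple s t = true ∧ win s t (a s) (b t) = false := by
  by_contra h
  push Not at h
  have h' : ∀ s t, inTriple s t = true → win s t (a s) (b t) = true := fun s t hst => by
    simpa using h s t hst
  have hrow : ∀ r j, parity (a (.inl r)) = false ∧ a (.inl r) j = b (r, j) := fun r j => by
    have := h' (.inl r) (r, j) (by simp [inTriple])
    simpa [win, requiredParity, idx] using this
  have hcol : ∀ c i, parity (a (.inr c)) = true ∧ a (.inr c) i = b (i, c) := fun c i => by
    have := h' (.inr c) (i, c) (by simp [inTriple])
    simpa [win, requiredParity, idx] using this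
  refine no_parity_matrix b (fun r => ?_) (fun c => ?_)
  · rw [← (hrow r 0).2, ← (hrow r 1).2, ← (hrow r 2).2]; exact (hrow r 0).1
  · rw [← (hcol c 0).2, ← (hcol c 1).2, ← (hcol c 2).2]; exact (hcol c 0).1

/-- Hence at most `17` of the `18` in-support pairs are won … [cite: CleveEtAl2004, §3.3] -/
theorem card_winSet_le (a : S → Fin 3 → Bool) (b : T → Bool) : (winSet a b).card ≤ 17 := by
  obtain ⟨s, t, hst, hlose⟩ := exists_loss a b
  have hsub : winSet a b ⊆ tripleSet.erase (s, t) := by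
    intro x hx
    simp only [winSet, mem_filter, mem_univ, true_and] at hx
    refine mem_erase.mpr ⟨?_, by simp [tripleSet, hx.1]⟩
    rintro rfl
    exact absurd hx.2 (by simp [hlose])
  have := card_le_card hsub
  rwa [card_erase_of_mem (by simp [tripleSet, hst]), card_tripleSet] at this

/-- … and every deterministic strategy has value at most `17/18`. [cite: CleveEtAl2004, §3.3] -/
theorem detValue_le (a : S → Fin 3 → Bool) (b : T → Bool) : magicSquare.detValue a b ≤ 17 / 18 := by
  rw [detValue_eq]
  have := card_winSet_le a b
  have : ((winSet a b).card : ℝ) ≤ 17 := by exact_mod_cast this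
  linarith

/-- Bob's optimal matrix: rows even, columns `0, 1` odd, column `2` even (the unavoidable defect). [folklore] -/
def bob₀ : T → Bool := fun t => decide (t.1 = 2 ∧ t.2 ≠ 2)

/-- Alice's optimal answers: the rows and the columns `0, 1` of Bob's matrix, and `(0,0,1)` for
column `2`. [folklore] -/
def alice₀ : S → Fin 3 → Bool
  | .inl r => fun j => bob₀ (r, j)
  | .inr c => fun i => if c = 2 then decide (i = 2) else bob₀ (i, c)

/-- This strategy wins `17` of the `18` pairs (it loses only `(column 2, entry (2,2))`). [cite:
CleveEtAl2004, §3.3] -/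
theorem card_winSet_alice₀_bob₀ : (winSet alice₀ bob₀).card = 17 := by decide

/-- A deterministic strategy of value `17/18`. [cite: CleveEtAl2004, §3.3] -/
theorem detValue_alice₀_bob₀ : magicSquare.detValue alice₀ bob₀ = 17 / 18 := by
  rw [detValue_eq, card_winSet_alice₀_bob₀]; norm_num

end MagicSquare

/-- **`ω_c(G) = 17/18` for the Magic Square game** (“It is not hard to see that ω_c(G) = 17/18
for this game”). [cite: CleveEtAl2004, §3.3] -/
theorem classicalValue_magicSquare : magicSquare.classicalValue = 17 / 18 :=
  le_antisymm (NonlocalGame.classicalValue_le MagicSquare.detValue_le)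
    (MagicSquare.detValue_alice₀_bob₀ ▸ magicSquare.detValue_le_classicalValue _ _)

/-! ## The Mermin–Peres square of observables: the algebra behind the perfect quantum strategy -/

namespace MagicSquare

open Matrix Literature.InformationTheory.Entanglement.Tsirelson
open scoped Kronecker

/-- The `3 × 3` matrix of two-qubit observables of the perfect strategy:
`[[σx⊗σy, σy⊗σx, σz⊗σz], [σy⊗σz, σz⊗σy, σx⊗σx], [σz⊗σx, σx⊗σz, σy⊗σy]]`.
[cite: CleveEtAl2004, §3.3 (display of the 3 × 3 matrix of observables)] -/
noncomputable def obs (i j : Fin 3) : Matrix (Bool × Bool) (Bool × Bool) ℂ :=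
  (![![Pauli.X, Pauli.Y, Pauli.Z], ![Pauli.Y, Pauli.Z, Pauli.X], ![Pauli.Z, Pauli.X, Pauli.Y]] i j).mat ⊗ₖ
    (![![Pauli.Y, Pauli.X, Pauli.Z], ![Pauli.Z, Pauli.Y, Pauli.X], ![Pauli.X, Pauli.Z, Pauli.Y]] i j).mat

/-- `σ_x σ_y = i σ_z` (and cyclic), `σ_y σ_x = −i σ_z` (and cyclic): “the Pauli matrices
anti-commute in pairs”. [cite: CleveEtAl2004, §3.3 eq. (σ_xσ_y = −σ_yσ_x, …)] -/
theorem pauli_mul_table :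
    Pauli.X.mat * Pauli.Y.mat = Complex.I • Pauli.Z.mat ∧
    Pauli.Y.mat * Pauli.Z.mat = Complex.I • Pauli.X.mat ∧
    Pauli.Z.mat * Pauli.X.mat = Complex.I • Pauli.Y.mat ∧
    Pauli.Y.mat * Pauli.X.mat = -(Complex.I • Pauli.Z.mat) ∧
    Pauli.Z.mat * Pauli.Y.mat = -(Complex.I • Pauli.X.mat) ∧
    Pauli.X.mat * Pauli.Z.mat = -(Complex.I • Pauli.Y.mat) := by
  refine ⟨?_, ?_, ?_, ?_, ?_, ?_⟩ <;> ext a b <;> cases a <;> cases b <;> simp [Pauli.mul_apply_bool]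

/-- `A ⊗ (−B) = −(A ⊗ B)`. [folklore] -/
private theorem kron_neg {l m n p : Type*} (A : Matrix l m ℂ) (B : Matrix n p ℂ) :
    A ⊗ₖ (-B) = -(A ⊗ₖ B) := by
  ext ⟨i, k⟩ ⟨j, l⟩; simp [Matrix.kroneckerMap_apply]

/-- `(−A) ⊗ B = −(A ⊗ B)`. [folklore] -/
private theorem neg_kron {l m n p : Type*} (A : Matrix l m ℂ) (B : Matrix n p ℂ) :
    (-A) ⊗ₖ B = -(A ⊗ₖ B) := by
  ext ⟨i, k⟩ ⟨j, l⟩; simp [Matrix.kroneckerMap_apply]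

/-- Each observable of the square is a `±1`-valued observable: `O_{ij}² = 𝟙`. [cite: CleveEtAl2004,
§3.3 (“each time obtaining a ±1 outcome”)] -/
theorem obs_mul_self (i j : Fin 3) : obs i j * obs i j = 1 := by
  fin_cases i <;> fin_cases j <;>
    simp [obs, ← Matrix.mul_kronecker_mul, Pauli.mat_mul_self]

/-- “the observables commute within any row …” [cite: CleveEtAl2004, §3.3] -/
theorem obs_row_comm (i j j' : Fin 3) : obs i j * obs i j' = obs i j' * obs i j := by
  obtain ⟨hXY, hYZ, hZX, hYX, hZY, hXZ⟩ := pauli_mul_table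
  fin_cases i <;> fin_cases j <;> fin_cases j' <;>
    simp [obs, ← Matrix.mul_kronecker_mul, Pauli.mat_mul_self, hXY, hYZ, hZX, hYX, hZY, hXZ,
      kron_neg, neg_kron, Matrix.smul_kronecker, Matrix.kronecker_smul, smul_smul]

/-- “… or column.” [cite: CleveEtAl2004, §3.3] -/
theorem obs_col_comm (i i' j : Fin 3) : obs i j * obs i' j = obs i' j * obs i j := by
  obtain ⟨hXY, hYZ, hZX, hYX, hZY, hXZ⟩ := pauli_mul_table
  fin_cases i <;> fin_cases i' <;> fin_cases j <;>
    simp [obs, ← Matrix.mul_kronecker_mul, Pauli.mat_mul_self, hXY, hYZ, hZX, hYX, hZY, hXZ,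
      kron_neg, neg_kron, Matrix.smul_kronecker, Matrix.kronecker_smul, smul_smul]

/-- “the product of the observables in each row is equal to `𝟙 ⊗ 𝟙` …” (so a row measurement
always has EVEN parity). [cite: CleveEtAl2004, §3.3] -/
theorem obs_row_prod (i : Fin 3) : obs i 0 * obs i 1 * obs i 2 = 1 := by
  obtain ⟨hXY, hYZ, hZX, hYX, hZY, hXZ⟩ := pauli_mul_table
  fin_cases i <;>
    simp [obs, ← Matrix.mul_kronecker_mul, Pauli.mat_mul_self, hXY, hYZ, hZX, hYX, hZY, hXZ,
      kron_neg, Matrix.smul_kronecker, Matrix.kronecker_smul, smul_smul]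

/-- “… while the product of the observables in each column is `−𝟙 ⊗ 𝟙`” (so a column measurement
always has ODD parity). [cite: CleveEtAl2004, §3.3] -/
theorem obs_col_prod (j : Fin 3) : obs 0 j * obs 1 j * obs 2 j = -1 := by
  obtain ⟨hXY, hYZ, hZX, hYX, hZY, hXZ⟩ := pauli_mul_table
  fin_cases j <;>
    simp [obs, ← Matrix.mul_kronecker_mul, Pauli.mat_mul_self, hXY, hYZ, hZX,
      Matrix.smul_kronecker, Matrix.kronecker_smul, smul_smul]

/-- “`|ψ⁻⟩` is a `−1` eigenvector of each of the operators `σx⊗σx`, `σy⊗σy`, and `σz⊗σz`” (so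
Alice's and Bob's answers, read off two shared singlets, always agree). [cite: CleveEtAl2004,
§3.3 eq. (⟨ψ⁻|σ⊗σ|ψ⁻⟩ = −1)] -/
theorem psiMinus_eigen :
    (Pauli.X.mat ⊗ₖ Pauli.X.mat) *ᵥ Werner.psiMinus = -Werner.psiMinus ∧
    (Pauli.Y.mat ⊗ₖ Pauli.Y.mat) *ᵥ Werner.psiMinus = -Werner.psiMinus ∧
    (Pauli.Z.mat ⊗ₖ Pauli.Z.mat) *ᵥ Werner.psiMinus = -Werner.psiMinus := by
  refine ⟨?_, ?_, ?_⟩ <;>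
  · funext ⟨a, b⟩
    simp only [Matrix.mulVec, dotProduct, Fintype.sum_prod_type, Fintype.sum_bool,
      Matrix.kroneckerMap_apply, Pi.neg_apply, Werner.psiMinus]
    cases a <;> cases b <;> simp

/-- The expectation values `⟨ψ⁻|σ_i ⊗ σ_i|ψ⁻⟩ = −1`, `i = x, y, z` (the tree's
`Werner.expect_diag`). [cite: CleveEtAl2004, §3.3 (first observation)] -/
theorem psiMinus_expect_diag :
    vecState Werner.psiMinus (Pauli.X.mat ⊗ₖ Pauli.X.mat) = -1 ∧
    vecState Werner.psiMinus (Pauli.Y.mat ⊗ₖ Pauli.Y.mat) = -1 ∧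
    vecState Werner.psiMinus (Pauli.Z.mat ⊗ₖ Pauli.Z.mat) = -1 := Werner.expect_diag

end MagicSquare

end Literature.Computability.QuantumComplexity
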